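import Summits.QuantumFields.BalabanUV.Beta.FP.ScalarAveragingJetLetters
import Summits.QuantumFields.BalabanUV.Beta.FP.MixLoopInstanceBlockFamily
import Summits.QuantumFields.BalabanUV.Beta.FP.ScalarMinimiserLettersPt

/-!
# `Beta/FP/GhostLoopCountingMix` — road «FP» (binder row D1), organisation γ, row **(GH-a) COUNTING, piece (g4)** «the four scalar constraint loops in MIX mass
# currency»: THE (MIX-2) ENGINE AT THE 0-FORM ROOTED BLOCK FAMILY AND THE SCALAR MINIMISER's COLUMNS `𝓘_gh(c,u) := kerH (N−1) a c u` — the GHOST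
# TWIN of the owner's (INST-MIX) row `FP/MixLoopInstanceBlockFamily` (token for token: `blk ↦ scl`, radius multiplier `R₀+1`, columns `N⁴•colOf (KPerf…) ↦ kerH`),
# every power of `N` DISPLAYED ([folklore] index plumbing on `ℤ⁴`; no road object identified)

HONEST FRAMING (cell `pub-balaban`, β sub-cell, verbatim): discharging `BetaPertH` makes Bałaban's UV stability UNCONDITIONAL — a real constructive-QFT
result; it is NOT the continuum limit and NOT the Clay problem.  THIS MODULE is [folklore] finite-sum plumbing (support of a kernel ⟹ filtered windows) composed BY NAME with ACCEPTED tree theorems of this road: `MixLoopPowerCountingMass.coarse_mix2_secondMoment_le` (owner d1-p3-g7,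
RHOA-6c′), `MixLoopInstanceBlockFamily.loopKernel_eq_filter`
(t4-ne7b-formalise-leaf-02-g23, (INST-MIX)), `ScalarMinimiserLettersPt.exists_kerH_letters_Pt`∕`exists_kerH_coarseMoment_Pt` (t4-ne7b-formalise-leaf-10-g26, (I-gh)),
and this lineage's 0-form family `ScalarAveragingJetLetters` (`sclW`∕`sclFld`∕`sclBg`, `scl_support`, `scl_windowedMass_le_half`, `scl_mass₁_local`, …).  It asserts
nothing about Bałaban's objects, cites nothing, mints no `Prop` fact, has no `def`, 0 sorry.  NOT the identification of `T₂^{gh}`∕`T₄^{gh}` with the K_n-ghost's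
(MIX-2)∕(MIX-4) terms (that dictionary is KER-γ (α)'s, as for the gluon), NOT the instance number `ℓ₀·Σ_σ p σ` nor the `Q′`-normalisation of `𝓘_gh` (KER-γ (γ) ∕
LEDGER), NOT (MIX-4) (sibling file) ∕ (MIX-1)∕(MIX-3) (FILE C), NOT (GH-a) as a whole, NOT `Mix_n = O(1)`, NOT hbook, NOT D1, NOT BetaPertH, NOT continuum, NOT Clay.
HONEST DEPENDENCY: continuum YM on T⁴ ⇐ BetaPertH ∧ nine spine estimates (0/9 proved); BetaPertH ⇐ (D1) ∧ (D4) ∧ CAP+tail; G-an2-4 gates asym, D1 and NE2/3/4.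

ABSOLUTE RULE (cell charter, verbatim): «No internally-minted statement may enter as a cited fact. Every hypothesis is either kernel-proved in this package or a
verbatim quotation of a PUBLISHED theorem with page reference. The manuscript(s) under audit are NOT citable for their own disputed steps — they are the thing under
adjudication; programme-internal (2001/route/tribunal) claims are never citable.»

THE ROW (road-FP OWNER b2b-balaban-beta-d1-p3, `LEAVES-FP.md` row (GH-a) COUNTING (R-FP-28 (d)), piece list N-d1leaf05g12-1 verbatim): «(g4) the four scalar constraint
loops = MIX-3∕2∕1∕4 shapes in MASS currency BY NAME (`MixLoopPowerCounting(Mass∕Gamma∕Quartic)`)» — the `Q′`-jet loops among the KKT six at the scalar data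
`(Δ_B, Q′_B)` (`GhostPairingSplit.secondVar_kkt_eq_free_add_induced`, `GhostGramJets.hasDerivAt_ghostFirstVar`): `tr(𝓘Q̇′𝓘Q̇′)` (MIX-2), `tr(𝓘Q̈′)` (MIX-4),
`tr(ΓQ̇′ᵀ𝔊Q̇′)`-type (MIX-1), `tr(ΓḢ𝓘Q̇′)` (MIX-3); the pure loops are (g1)(g3), the Gram loops (g5) ✓, the far window (g2) ✓.  BINDING CHECK (R-FP-28 (d), displayed):
the loop typed here carries NO lattice difference — its smallness is mass × column counting only, exactly the engine's (MIX-2) shape.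

CURRENCY (the 0-form twin of (INST-MIX)'s, forced by the engines): background labels ARE fine points (`B = Pt`, `pos = id`); the radial path rules
`rad σ u x′ : List Pt` stay FREE with two displayed letters (length `≤ ℓ₀`, radius «`ℓ ∈ rad σ u x′`, `x′ ∈ fineBlock N` ⟹ `‖ℓ − N•u‖∞ ≤ R₀·N`», ℕ-valued), the
probabilities `p σ ≥ 0` stay FREE (NOT pinned to `Σp = 1`), the scalar minimiser's parameter `a > 0` is free (every `a` gives the same kernel — (I-gh)).

CONTENT.  §1 support plumbing READ OFF `scl_support`: `supNorm_le_of_mem_fineBlock` (`‖x′‖∞ ≤ N`), **`scl_ker₁_ins_local`** ((U): `ker₁^{(u)} b c ≠ 0 ⟹ ‖b − N•u‖∞ ≤ R₀N`),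
**`scl_ker₁_fld_local`** ((W): `⟹ ‖c − b‖∞ ≤ (R₀+1)N` — a block site is within `N` of its anchor).  §2 **`windowedMass_scl_le`** = the engine's (M)-letter for
`M(b) = Σ_{u∈U b}Σ_{w∈W}|ker₁^{(u)} b (b+w)|`, ANY `U`, ANY finite `W`, bound `A_M := (ℓ₀·Σp)·e^{δR₀∕2}·(e^{δ∕2}(1+480e^{δ∕4}(4∕δ)⁴))` (`scl_windowedMass_le_half` BY NAME);
**`coarse_mix2_secondMoment_scl`** (abstract legs `I`, `J` under (I)(J)(J′), radius letters (U)(W) with `R := R₀+1`).  §3 **`coarse_mix2_secondMoment_scl_free`** (ARBITRARY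
finite coarse∕offset windows `Y`, `W`; far terms vanish by `loopKernel_eq_filter` BY NAME).  §4 `ghostColumn_engineLetters` (the (I-gh) letters packaged: ONE `C, C′ ≥ 0`
for all `a > 0`, `N ≥ 1`) and THE END **`ghost_mix2_rem`** (`∃ C C′` BEFORE `∀ a N` and before the family data):
`Σ_{v∈V}‖v−v₀‖∞²·|Σ_{b,b′∈S} 𝓘_gh(b,v₀)·𝓘_gh(b′,v)·Σ_{u,u′∈Y}(Σ_{w∈W} ker₁^{(u)} b (b+w)·𝓘_gh(b+w,u′))·(Σ_{w′∈W} ker₁^{(u′)} b′ (b′+w′)·𝓘_gh(b′+w′,u))|`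
`≤ 3·(C·e^{2(R₀+1)δ})²·C·C′·(1+20∕δ²)·((ℓ₀·Σ_σ p σ)·e^{δR₀∕2}·(e^{δ∕2}(1+480e^{δ∕4}(4∕δ)⁴)))²`, `δ = deltaH 4 1`.  The (MIX-4) twin `ghost_mix4_rem` (second jet
`ker₂`, pair weight read off one radial word, (M₂)) is the sibling file `FP/GhostLoopCountingMixQuartic`; (MIX-1)∕(MIX-3) (Γ∕𝔊∕Ḣ letters displayed) = FILE C.
WHERE THE `N` SITS (displayed, not hidden; hand count for the record, NOT asserted): the kerH letters are O(1) in `N` in the block-AVERAGE normalisation of (I-gh) (`C`, `C′` free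
of `N` and `a`), the 0-form family's windowed masses are `ℓ₀·Σp` resp. `2ℓ₀²·Σp` × numbers; so (MIX-2)^{gh} reads `N⁰·(ℓ₀·Σp)²` — n-free iff
`ℓ₀·Σ_σ p σ ≲ 1` AFTER the LEDGER fixes `Q′`'s normalisation against `𝓘_gh`'s (a block SUM moves `N^{∓4}` between `p` and `C`); with a comb∕staircase rule
`ℓ₀ ≤ (2d+2)N` this is the instance number KER-γ (γ) pins — displayed, not decided, exactly as (INST-MIX)'s «n-free iff (ℓ₀+N)Σp ≲ N²».
Provenance: D1 formalisation swarm, unit `b2b-balaban-beta-d1-formalise-leaf-05` gen 14 (prover-…-leaf-05-g14-0), 2026-08-21, first refusal on (GH-a) (g4) exercised (journal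
INTENT 2026-08-21T03:56:26Z); «not in print; our bookkeeping»; no existing file touched.
-/

noncomputable section

namespace Summit.QuantumFields.BalabanUV.Beta.FP.GhostLoopCountingMix

open Finset Real
open scoped BigOperators
open Literature.MathematicalPhysics.QuantumFieldTheory.Balaban1983to89
open Literature.MathematicalPhysics.QuantumFieldTheory.Balaban1983to89.Beta
open DyadicShell (Pt supNorm supNorm_le_iff)
open BlockLegs (supNorm_sub_le_real)
open AxialBlockWeights (fineBlock mem_fineBlock)
open B5Hk103ScalarZd (kerH deltaH deltaH_pos)
open Summit.QuantumFields.BalabanUV.Beta.FP.AveragingJetLettersRooted (ker₁ mass₁ ker₁_nonneg mass₁_nonneg sum_ker₁_le_mass₁)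
open Summit.QuantumFields.BalabanUV.Beta.FP.ScalarAveragingJetLetters
  (sclW sclFld sclBg sclW_nonneg scl_support scl_windowedMass_le_half scl_mass₁_local scl_massFun_le length_sclBg_le)
open Summit.QuantumFields.BalabanUV.Beta.FP.MixLoopPowerCountingMass (coarse_mix2_secondMoment_le)
open Summit.QuantumFields.BalabanUV.Beta.FP.MixLoopInstanceBlockFamily (loopKernel_eq_filter)
open Summit.QuantumFields.BalabanUV.Beta.FP.ScalarMinimiserLettersPt (exists_kerH_letters_Pt exists_kerH_coarseMoment_Pt)

/-! ## §1 Support plumbing -/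

/-- [folklore] a site of the fine block sits within `N` of the corner: `‖x′‖∞ ≤ N` for `x′ ∈ fineBlock N`. -/
theorem supNorm_le_of_mem_fineBlock {N : ℕ} {x : Pt} (hx : x ∈ fineBlock N) : supNorm x ≤ N := by
  have h := mem_fineBlock.mp hx
  refine supNorm_le_iff.mpr fun i => ?_
  have h1 := h i
  omega

section Scalar

variable {σ : Type*} [Fintype σ] {N : ℕ} {p : σ → ℝ} {rad : σ → Pt → Pt → List Pt} {ℓ₀ R₀ : ℕ}

/-- **(U) READ OFF THE SUPPORT** ([folklore]): with point labels and the radial radius letter «`ℓ ∈ rad σ u x′`, `x′ ∈ fineBlock N` ⟹ `‖ℓ − N•u‖∞ ≤ R₀·N`», a nonzero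
entry `ker₁^{(u)} b c` of the block-`u` kernel of the 0-form family has its background insertion `b` within `R₀·N` of the anchor `N•u`. -/
theorem scl_ker₁_ins_local
    (hradR : ∀ (s : σ) (u : Pt) (x : ↥(fineBlock N)) (ℓ : Pt), ℓ ∈ rad s u x.1 → supNorm (ℓ - (N : ℤ) • u) ≤ R₀ * N)
    {u b c : Pt} (h : ker₁ (sclW N p) (sclFld N u) (sclBg N u rad) b c ≠ 0) :
    supNorm (b - (N : ℤ) • u) ≤ R₀ * N := by
  obtain ⟨x, hx, s, _, hb⟩ := scl_support h
  exact hradR s u ⟨x, hx⟩ b hb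

/-- **(W) READ OFF THE SUPPORT** ([folklore]): a nonzero entry `ker₁^{(u)} b c` has its field leg `c` within `(R₀+1)·N` of the background insertion `b`
(`c = N•u + x′` with `‖x′‖∞ ≤ N`, and (U)). -/
theorem scl_ker₁_fld_local
    (hradR : ∀ (s : σ) (u : Pt) (x : ↥(fineBlock N)) (ℓ : Pt), ℓ ∈ rad s u x.1 → supNorm (ℓ - (N : ℤ) • u) ≤ R₀ * N)
    {u b c : Pt} (h : ker₁ (sclW N p) (sclFld N u) (sclBg N u rad) b c ≠ 0) :
    supNorm (c - b) ≤ (R₀ + 1) * N := by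
  have hb := scl_ker₁_ins_local (p := p) hradR h
  obtain ⟨x, hx, s, hc, _⟩ := scl_support h
  have hcz : c - (N : ℤ) • u = x := by
    rw [← hc, ← natCast_zsmul u N]; abel
  have h1 : supNorm (c - (N : ℤ) • u) ≤ N := by rw [hcz]; exact supNorm_le_of_mem_fineBlock hx
  have e : c - b = (c - (N : ℤ) • u) - (b - (N : ℤ) • u) := by abel
  have hreal : (supNorm (c - b) : ℝ) ≤ supNorm (c - (N : ℤ) • u) + supNorm (b - (N : ℤ) • u) := by
    rw [e]; exact supNorm_sub_le_real _ _
  have h2 : (supNorm (c - b) : ℝ) ≤ (N : ℕ) + (R₀ * N : ℕ) := by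
    have h1' : (supNorm (c - (N : ℤ) • u) : ℝ) ≤ (N : ℕ) := by exact_mod_cast h1
    have hb' : (supNorm (b - (N : ℤ) • u) : ℝ) ≤ (R₀ * N : ℕ) := by exact_mod_cast hb
    linarith
  have h3 : supNorm (c - b) ≤ N + R₀ * N := by exact_mod_cast h2
  calc supNorm (c - b) ≤ N + R₀ * N := h3
    _ = (R₀ + 1) * N := by ring

/-! ## §2 The engine's (M)-letter and the (MIX-2) engine at the 0-form family, abstract legs -/

/-- **(M) FOR THE ENGINE's MASS `M(b) = Σ_{u∈U b} Σ_{w∈W} |ker₁^{(u)} b (b+w)|` AT THE 0-FORM FAMILY** ([folklore]; ANY coarse windows `U b`, ANY finite offset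
window `W`, every fine centre `c`): `Σ_{b∈S} e^{−(δ∕(2N))‖b−c‖∞}·M(b) ≤ (ℓ₀·Σ_σ p σ)·e^{δR₀∕2}·(e^{δ∕2}(1+480e^{δ∕4}(4∕δ)⁴))` — `Σ_{w∈W} ker₁^{(u)} b (b+w) ≤ mass₁^{(u)} b`
(`sum_ker₁_le_mass₁` on the translated window), `U b ⊆ S.biUnion U`, then `ScalarAveragingJetLetters.scl_windowedMass_le_half` BY NAME at `pos = id`. -/
theorem windowedMass_scl_le {δ : ℝ} (hδ : 0 < δ) (hN : 1 ≤ N) (hp : ∀ s, 0 ≤ p s)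
    (hrad : ∀ s u x', (rad s u x').length ≤ ℓ₀)
    (hradR : ∀ (s : σ) (u : Pt) (x : ↥(fineBlock N)) (ℓ : Pt), ℓ ∈ rad s u x.1 → supNorm (ℓ - (N : ℤ) • u) ≤ R₀ * N)
    (U : Pt → Finset Pt) (W S : Finset Pt) (c : Pt) :
    ∑ b ∈ S, Real.exp (-(δ / (2 * N)) * (supNorm (b - c) : ℝ)) *
        (∑ u ∈ U b, ∑ w ∈ W, |ker₁ (sclW N p) (sclFld N u) (sclBg N u rad) b (b + w)|)
      ≤ (((ℓ₀ : ℕ) : ℝ) * ∑ s, p s) * Real.exp (δ * R₀ / 2) *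
          (Real.exp (δ / 2) * (1 + 480 * Real.exp (δ / 4) * (4 / δ) ^ 4)) := by
  classical
  set Y : Finset Pt := S.biUnion U with hY
  have hω := sclW_nonneg N hp
  -- the inner mass of the engine is at most the windowed family mass over `Y`
  have hinner : ∀ b ∈ S, ∑ u ∈ U b, ∑ w ∈ W, |ker₁ (sclW N p) (sclFld N u) (sclBg N u rad) b (b + w)|
      ≤ ∑ u ∈ Y, mass₁ (sclW N p) (sclBg N u rad) b := by
    intro b hb
    have hUb : U b ⊆ Y := by rw [hY]; exact Finset.subset_biUnion_of_mem U hb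
    have hw : ∀ u, ∑ w ∈ W, |ker₁ (sclW N p) (sclFld N u) (sclBg N u rad) b (b + w)|
        ≤ mass₁ (sclW N p) (sclBg N u rad) b := by
      intro u
      have habs : ∀ w, |ker₁ (sclW N p) (sclFld N u) (sclBg N u rad) b (b + w)|
          = ker₁ (sclW N p) (sclFld N u) (sclBg N u rad) b (b + w) := fun w => abs_of_nonneg (ker₁_nonneg hω _ _)
      simp only [habs]
      rw [← Finset.sum_image (s := W) (g := fun w => b + w) (f := fun c' => ker₁ (sclW N p) (sclFld N u) (sclBg N u rad) b c')
        (fun x _ y _ h => add_left_cancel h)]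
      exact sum_ker₁_le_mass₁ hω _ b
    calc ∑ u ∈ U b, ∑ w ∈ W, |ker₁ (sclW N p) (sclFld N u) (sclBg N u rad) b (b + w)|
        ≤ ∑ u ∈ U b, mass₁ (sclW N p) (sclBg N u rad) b := Finset.sum_le_sum fun u _ => hw u
      _ ≤ ∑ u ∈ Y, mass₁ (sclW N p) (sclBg N u rad) b :=
          Finset.sum_le_sum_of_subset_of_nonneg hUb fun u _ _ => mass₁_nonneg hω b
  have hradR' : ∀ (s : σ) (u : Pt) (x : ↥(fineBlock N)) (ℓ : Pt), ℓ ∈ rad s u x.1 →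
      (supNorm (id ℓ - (N : ℤ) • u) : ℝ) ≤ (R₀ : ℝ) * N := by
    intro s u x ℓ h
    have h' := hradR s u x ℓ h
    rw [id]
    exact_mod_cast h'
  have hM := scl_windowedMass_le_half (B := Pt) hδ hN hp hrad id hradR' S Y c
  calc ∑ b ∈ S, Real.exp (-(δ / (2 * N)) * (supNorm (b - c) : ℝ)) *
          (∑ u ∈ U b, ∑ w ∈ W, |ker₁ (sclW N p) (sclFld N u) (sclBg N u rad) b (b + w)|)
      ≤ ∑ b ∈ S, Real.exp (-(δ / (2 * N)) * (supNorm (b - c) : ℝ)) * ∑ u ∈ Y, mass₁ (sclW N p) (sclBg N u rad) b :=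
        Finset.sum_le_sum fun b hb => mul_le_mul_of_nonneg_left (hinner b hb) (Real.exp_pos _).le
    _ ≤ _ := by simpa only [id] using hM

/-- **THE (MIX-2) ENGINE AT THE 0-FORM FAMILY, ABSTRACT LEGS** ([folklore] plumbing; the engine `coarse_mix2_secondMoment_le` BY NAME with
`qd u b c := ker₁ (sclW N p) (sclFld N u) (sclBg N u rad) b c`, radius multiplier `R := R₀ + 1`, (M) := `windowedMass_scl_le`): under the radius letters
(U) `u ∈ U b ⟹ ‖b − N•u‖∞ ≤ (R₀+1)N`, (W) `w ∈ W ⟹ ‖w‖∞ ≤ (R₀+1)N` and the leg letters (I) `|I c u| ≤ C_I·e^{−(δ∕N)‖c − N•u‖∞}`, (J) `|J b v₀| ≤ C_J·e^{−(δ∕N)‖b − N•v₀‖∞}`,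
(J′) `Σ_{v∈V}(1 + (‖b′ − N•v‖∞∕N)²)|J b′ v| ≤ C_J′`, for all finite `S`, `V` and every `v₀`:
`Σ_{v∈V}‖v−v₀‖∞²·|Σ_{b,b′∈S} J b v₀·J b′ v·k₂(b,b′)| ≤ 3·(C_I·e^{2(R₀+1)δ})²·C_J·C_J′·(1+20∕δ²)·A_M²`, `A_M = (ℓ₀·Σp)·e^{δR₀∕2}·(e^{δ∕2}(1+480e^{δ∕4}(4∕δ)⁴))`. -/
theorem coarse_mix2_secondMoment_scl {δ : ℝ} (hδ : 0 < δ) (hN : 1 ≤ N) (hp : ∀ s, 0 ≤ p s)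
    (hrad : ∀ s u x', (rad s u x').length ≤ ℓ₀)
    (hradR : ∀ (s : σ) (u : Pt) (x : ↥(fineBlock N)) (ℓ : Pt), ℓ ∈ rad s u x.1 → supNorm (ℓ - (N : ℤ) • u) ≤ R₀ * N)
    {U : Pt → Finset Pt} (hU : ∀ b, ∀ u ∈ U b, supNorm (b - (N : ℤ) • u) ≤ (R₀ + 1) * N)
    {W : Finset Pt} (hW : ∀ w ∈ W, supNorm w ≤ (R₀ + 1) * N)
    {I J : Pt → Pt → ℝ} {C_I C_J C_J' : ℝ}
    (hI : ∀ c u, |I c u| ≤ C_I * Real.exp (-(δ / N) * (supNorm (c - (N : ℤ) • u) : ℝ)))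
    (S V : Finset Pt) (v₀ : Pt)
    (hJ : ∀ b, |J b v₀| ≤ C_J * Real.exp (-(δ / N) * (supNorm (b - (N : ℤ) • v₀) : ℝ)))
    (hJ' : ∀ b', ∑ v ∈ V, (1 + ((supNorm (b' - (N : ℤ) • v) : ℝ) / N) ^ 2) * |J b' v| ≤ C_J') :
    ∑ v ∈ V, (supNorm (v - v₀) : ℝ) ^ 2 *
        |∑ b ∈ S, ∑ b' ∈ S, J b v₀ * J b' v *
          (∑ u ∈ U b, ∑ u' ∈ U b',
            (∑ w ∈ W, ker₁ (sclW N p) (sclFld N u) (sclBg N u rad) b (b + w) * I (b + w) u') *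
            (∑ w' ∈ W, ker₁ (sclW N p) (sclFld N u') (sclBg N u' rad) b' (b' + w') * I (b' + w') u))|
      ≤ 3 * (C_I * Real.exp (2 * ((R₀ : ℝ) + 1) * δ)) ^ 2 * C_J * C_J' * (1 + 20 / δ ^ 2) *
          ((((ℓ₀ : ℕ) : ℝ) * ∑ s, p s) * Real.exp (δ * R₀ / 2) *
            (Real.exp (δ / 2) * (1 + 480 * Real.exp (δ / 4) * (4 / δ) ^ 4))) ^ 2 := by
  have h := coarse_mix2_secondMoment_le
    (qd := fun u b c => ker₁ (sclW N p) (sclFld N u) (sclBg N u rad) b c) (R := R₀ + 1)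
    hδ hN hU hW hI S V v₀ hJ hJ' (fun c => windowedMass_scl_le hδ hN hp hrad hradR U W S c)
  have e : (((R₀ + 1 : ℕ) : ℝ)) = (R₀ : ℝ) + 1 := by push_cast; ring
  rw [e] at h
  exact h

/-! ## §3 Free windows: the far terms vanish -/

/-- **THE (MIX-2) ENGINE AT THE 0-FORM FAMILY, FREE WINDOWS** ([folklore]): the bound of `coarse_mix2_secondMoment_scl` for the loop kernel summed over ARBITRARY
finite coarse and offset windows `Y`, `W` — NO radius hypothesis on them: a far coarse site contributes a vanishing jet row (`scl_ker₁_ins_local`), a far offset a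
vanishing entry (`scl_ker₁_fld_local`), so the kernel IS the one over the filtered windows (`MixLoopInstanceBlockFamily.loopKernel_eq_filter` BY NAME), to which
`coarse_mix2_secondMoment_scl` applies with radius multiplier `R₀ + 1`. -/
theorem coarse_mix2_secondMoment_scl_free {δ : ℝ} (hδ : 0 < δ) (hN : 1 ≤ N) (hp : ∀ s, 0 ≤ p s)
    (hrad : ∀ s u x', (rad s u x').length ≤ ℓ₀)
    (hradR : ∀ (s : σ) (u : Pt) (x : ↥(fineBlock N)) (ℓ : Pt), ℓ ∈ rad s u x.1 → supNorm (ℓ - (N : ℤ) • u) ≤ R₀ * N)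
    (Y W : Finset Pt) {I J : Pt → Pt → ℝ} {C_I C_J C_J' : ℝ}
    (hI : ∀ c u, |I c u| ≤ C_I * Real.exp (-(δ / N) * (supNorm (c - (N : ℤ) • u) : ℝ)))
    (S V : Finset Pt) (v₀ : Pt)
    (hJ : ∀ b, |J b v₀| ≤ C_J * Real.exp (-(δ / N) * (supNorm (b - (N : ℤ) • v₀) : ℝ)))
    (hJ' : ∀ b', ∑ v ∈ V, (1 + ((supNorm (b' - (N : ℤ) • v) : ℝ) / N) ^ 2) * |J b' v| ≤ C_J') :
    ∑ v ∈ V, (supNorm (v - v₀) : ℝ) ^ 2 *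
        |∑ b ∈ S, ∑ b' ∈ S, J b v₀ * J b' v *
          (∑ u ∈ Y, ∑ u' ∈ Y,
            (∑ w ∈ W, ker₁ (sclW N p) (sclFld N u) (sclBg N u rad) b (b + w) * I (b + w) u') *
            (∑ w' ∈ W, ker₁ (sclW N p) (sclFld N u') (sclBg N u' rad) b' (b' + w') * I (b' + w') u))|
      ≤ 3 * (C_I * Real.exp (2 * ((R₀ : ℝ) + 1) * δ)) ^ 2 * C_J * C_J' * (1 + 20 / δ ^ 2) *
          ((((ℓ₀ : ℕ) : ℝ) * ∑ s, p s) * Real.exp (δ * R₀ / 2) *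
            (Real.exp (δ / 2) * (1 + 480 * Real.exp (δ / 4) * (4 / δ) ^ 4))) ^ 2 := by
  classical
  have hzU : ∀ u b c, ¬ supNorm (b - (N : ℤ) • u) ≤ R₀ * N →
      ker₁ (sclW N p) (sclFld N u) (sclBg N u rad) b c = 0 := by
    intro u b c hfar
    by_contra hne
    exact hfar (scl_ker₁_ins_local hradR hne)
  have hzW : ∀ u b w, ¬ supNorm w ≤ (R₀ + 1) * N →
      ker₁ (sclW N p) (sclFld N u) (sclBg N u rad) b (b + w) = 0 := by
    intro u b w hfar
    by_contra hne
    have h := scl_ker₁_fld_local hradR hne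
    rw [add_sub_cancel_left] at h
    exact hfar h
  have hUr : ∀ b, ∀ u ∈ Y.filter (fun u => supNorm (b - (N : ℤ) • u) ≤ R₀ * N), supNorm (b - (N : ℤ) • u) ≤ (R₀ + 1) * N := by
    intro b u hu
    calc supNorm (b - (N : ℤ) • u) ≤ R₀ * N := (Finset.mem_filter.mp hu).2
      _ ≤ (R₀ + 1) * N := Nat.mul_le_mul_right N (Nat.le_add_right R₀ 1)
  have hWr : ∀ w ∈ W.filter (fun w => supNorm w ≤ (R₀ + 1) * N), supNorm w ≤ (R₀ + 1) * N :=
    fun w hw => (Finset.mem_filter.mp hw).2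
  have hA := coarse_mix2_secondMoment_scl hδ hN hp hrad hradR hUr hWr hI S V v₀ hJ hJ'
  have hker := fun b b' => loopKernel_eq_filter (q := fun u b c => ker₁ (sclW N p) (sclFld N u) (sclBg N u rad) b c) I
    (fun b u => supNorm (b - (N : ℤ) • u) ≤ R₀ * N) (fun w => supNorm w ≤ (R₀ + 1) * N) hzU hzW Y W b b'
  simp only [hker]
  exact hA

end Scalar

/-! ## §4 The scalar minimiser's columns and the (MIX-2) END -/

/-- **THE (I-gh) LETTERS PACKAGED** ([folklore]; `ScalarMinimiserLettersPt.exists_kerH_letters_Pt` + `exists_kerH_coarseMoment_Pt` BY NAME): ONE `C ≥ 0`, `C′ ≥ 0`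
such that for ALL `a > 0`, `N ≥ 1`: (I)∕(J) `|kerH (N−1) a c u| ≤ C·e^{−(δ∕N)‖c − N•u‖∞}` and (J′) `Σ_{v∈V}(1 + (‖b′ − N•v‖∞∕N)²)|kerH (N−1) a b′ v| ≤ C′` (every finite `V`),
`δ = deltaH 4 1` — the columns are O(1) in `N` in (I-gh)'s block-average normalisation. -/
theorem ghostColumn_engineLetters :
    ∃ C C' : ℝ, 0 ≤ C ∧ 0 ≤ C' ∧ ∀ {a : ℝ}, 0 < a → ∀ (N : ℕ), 1 ≤ N →
      (∀ c u : Pt, |kerH (N - 1) a c u| ≤ C * Real.exp (-(deltaH 4 1 / N) * (supNorm (c - (N : ℤ) • u) : ℝ))) ∧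
      (∀ (b' : Pt) (V : Finset Pt),
        ∑ v ∈ V, (1 + ((supNorm (b' - (N : ℤ) • v) : ℝ) / N) ^ 2) * |kerH (N - 1) a b' v| ≤ C') := by
  obtain ⟨C, hC, h⟩ := exists_kerH_letters_Pt
  obtain ⟨C', hC', h'⟩ := exists_kerH_coarseMoment_Pt
  exact ⟨C, C', hC, hC', fun {a} ha N hN => ⟨fun c u => (h ha N hN c u).1, fun b' V => h' ha N hN b' V⟩⟩

/-- **THE END `ghost_mix2_rem` — ROW (GH-a) PIECE (g4), THE (MIX-2) GHOST TWIN OF (INST-MIX)'s `mix2_rem_blockFamily`** ([our object]; `d = 4`): there are `C, C′ ≥ 0`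
(the scalar minimiser's letters, `ghostColumn_engineLetters`) such that for EVERY `a > 0`, EVERY blocking `N ≥ 1`, every 0-form rooted block family at blocking `N`
(rules `σ` with probabilities `p σ ≥ 0`, radial words `rad σ u x′` of length `≤ ℓ₀` within `R₀·N` of the anchor; point labels), all finite windows `Y` (coarse), `W`
(field-leg offsets), `S` (insertions), `V` (running coarse sites) and every `v₀`, with `𝓘_gh(c,u) := kerH (N−1) a c u` and `δ := deltaH 4 1`:
`Σ_{v∈V}‖v−v₀‖∞²·|Σ_{b,b′∈S} 𝓘_gh(b,v₀)·𝓘_gh(b′,v)·Σ_{u,u′∈Y}(Σ_{w∈W} ker₁^{(u)} b (b+w)·𝓘_gh(b+w,u′))·(Σ_{w′∈W} ker₁^{(u′)} b′ (b′+w′)·𝓘_gh(b′+w′,u))|`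
`≤ 3·(C·e^{2(R₀+1)δ})²·C·C′·(1+20∕δ²)·((ℓ₀·Σ_σ p σ)·e^{δR₀∕2}·(e^{δ∕2}(1+480e^{δ∕4}(4∕δ)⁴)))²` — EVERY power of `N` displayed: `N⁰·(ℓ₀·Σp)²` times numbers (instance
number + `Q′`-normalisation = KER-γ (γ) ∕ LEDGER).  `∃ C C′` stands BEFORE `∀ a N` and before the family data (which may depend on `N`).  NOT the identification with the
K_n-ghost's (MIX-2) term, NOT `Mix_n = O(1)`, NOT (GH-a), NOT hbook, NOT D1, NOT BetaPertH. -/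
theorem ghost_mix2_rem :
    ∃ C C' : ℝ, 0 ≤ C ∧ 0 ≤ C' ∧ ∀ {a : ℝ}, 0 < a → ∀ (N : ℕ), 1 ≤ N →
      ∀ {σ : Type*} [Fintype σ] {p : σ → ℝ} (_ : ∀ s, 0 ≤ p s)
        {rad : σ → Pt → Pt → List Pt} {ℓ₀ R₀ : ℕ} (_ : ∀ s u x', (rad s u x').length ≤ ℓ₀)
        (_ : ∀ (s : σ) (u : Pt) (x : ↥(fineBlock N)) (ℓ : Pt), ℓ ∈ rad s u x.1 → supNorm (ℓ - (N : ℤ) • u) ≤ R₀ * N)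
        (Y W S V : Finset Pt) (v₀ : Pt),
        ∑ v ∈ V, (supNorm (v - v₀) : ℝ) ^ 2 *
            |∑ b ∈ S, ∑ b' ∈ S, kerH (N - 1) a b v₀ * kerH (N - 1) a b' v *
              (∑ u ∈ Y, ∑ u' ∈ Y,
                (∑ w ∈ W, ker₁ (sclW N p) (sclFld N u) (sclBg N u rad) b (b + w) * kerH (N - 1) a (b + w) u') *
                (∑ w' ∈ W, ker₁ (sclW N p) (sclFld N u') (sclBg N u' rad) b' (b' + w') * kerH (N - 1) a (b' + w') u))|
          ≤ 3 * (C * Real.exp (2 * ((R₀ : ℝ) + 1) * deltaH 4 1)) ^ 2 * C * C' * (1 + 20 / deltaH 4 1 ^ 2) *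
              ((((ℓ₀ : ℕ) : ℝ) * ∑ s, p s) * Real.exp (deltaH 4 1 * R₀ / 2) *
                (Real.exp (deltaH 4 1 / 2) * (1 + 480 * Real.exp (deltaH 4 1 / 4) * (4 / deltaH 4 1) ^ 4))) ^ 2 := by
  obtain ⟨C, C', hC, hC', h⟩ := ghostColumn_engineLetters
  refine ⟨C, C', hC, hC', fun {a} ha N hN σ _ p hp rad ℓ₀ R₀ hrad hradR Y W S V v₀ => ?_⟩
  have hδ : 0 < deltaH 4 1 := deltaH_pos 4 one_pos
  obtain ⟨hI, hJ'⟩ := h ha N hN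
  exact coarse_mix2_secondMoment_scl_free (N := N) hδ hN hp hrad hradR Y W
    (I := fun c u => kerH (N - 1) a c u) (J := fun b v => kerH (N - 1) a b v)
    (fun c u => hI c u) S V v₀ (fun b => hI b v₀) (fun b' => hJ' b' V)

end Summit.QuantumFields.BalabanUV.Beta.FP.GhostLoopCountingMix

end
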